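import Summits.BirchSwinnertonDyer.BirchSwinnertonDyer.Theorems.SylvesterTwoHeegnerIndexCoupledDescentCebotarevPrep
import Literature.NumberTheory.EllipticCurves.HeegnerPointsKolyvaginCebotarevPairProofs
import Literature.NumberTheory.EllipticCurves.HeegnerPointsKolyvaginPairingCMPair
import Literature.NumberTheory.EllipticCurves.HeegnerPointsKolyvaginExceptionalSelmerProofs
import Literature.NumberTheory.Automorphic.ChebotarevArtinRepHolds
import HarnessLib

/-!
# Leaf (L3) of the coupled Kolyvagin descent — the Čebotarev realizability clauses, assembled

Helper toward crux `UpperOffV0HSYPlus` (stmt-BirchSwinnertonDyer-19804) of route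
`SylvesterTwoHeegnerIndex` (rung K7t, leaf `X12.CMAtTwo`), skeleton VARIANT K. The deduction
`SylvesterTwoCoupledDescent.selmerGroup_eq_bot_and_le_closure_of_coupledLeaves`
(`Theorems/SylvesterTwoHeegnerIndexCoupledDescentAtTwo.lean`, THEOREM K2 of memo two §57.4) takes
three leaf-shaped hypotheses; leaf (L3) «Čebotarev realizability» consists of the two clauses

* (hL3a) for classes `s ∈ H¹(K, A_K[p])`, `t ∈ H¹(K, B_K[p])`: infinitely many Kolyvagin primes `ℓ`
  at whose place `λ` the non-zero ones among `s`, `t` have non-zero localisation;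
* (hL3b) for `y` (the bottom class `δY`), `s` off the `(ℤ/p)[w]`-line of `y`, and `c ≠ 0` on the
  other curve: infinitely many Kolyvagin `ℓ` with `y_λ = 0`, `s_λ ≠ 0`, `c_λ ≠ 0`.

This file PROVES clause (a), `infinite_kolyvaginPrimes_ne` (clause (b) is the sibling
`…CoupledDescentCebotarevLine`), in the quantifier shape of that theorem, for ANY two elliptic
curves `A`, `B` over `ℚ`, any imaginary quadratic `K` with its conjugation `c` and the involutive
lift `τ = e c₀ e⁻¹`, and any prime `p ≠ 3`, with «Kolyvagin prime» spelled out as `ℓ` prime,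
`ℓ ∤ N_A`, `ℓ ∤ N_B`, `ℓ ∤ d_K`, `ℓ ≠ p`, `(ℓ)` prime in `𝓞 K`, `Frob(ℓ) = Frob(∞)` on `K(A_p)` and
on `K(B_p)` (`FrobEqFrobInfty`), from the tree's `exists_h1Eval_eq_pair_of_comm` (Gross Prop. 9.3,
commuting form, PAIR: the joint `ρ`), `exists_kolyvaginPrime_gt_of_galoisElement_pair` (McCallum
Prop. 3.1 Čebotarev step for a pair, any `p`, here at level `p = p¹`), the Čebotarev density
theorem `Automorphic.chebotarev_artinRep_holds` (DISCHARGED), and `…CoupledDescentCebotarevPrep`.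

DISPLAYED HYPOTHESES (the module-theoretic inputs of the `…PairingCM*` files, per curve
`X ∈ {A, B}`): `X[p]` simple under `Γ_K` (`hS`), an additive `w` on `X[p]` with `w³ = 1` and
commutant `{a + b w}` (`hC`), the action through commuting operators (`hcomm`) with some `z - 1`
inverted by `ι`, an operator `wH` on `H¹(K, X[p])` with `wH² + wH + 1 = 0` lying over `w` on
evaluations (`hwH`), the semilinearities `σ_* (wH x) = wH (wH (σ_* x))`, `τ (w P) = w (w (τ P))`, a
point `e′` with `(τe′ + e′, w(τe′ + e′))` `p`-independent, and across the curves an exponent (E) and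
an element (Z) witnessing `K(A[p]) ≠ K(B[p])`. In the HSY frame (`p = 2`, `K = ℚ(ω)`,
`A = E_{3p²}`, `B = E_p`, `w = [ω]`, `e = 3`) each is a tree theorem or elementary. Nothing here is
specific to `2`; nothing is asserted about 19804; no definition, no named fact; BSD is not claimed.
-/

-- every Summits module is named `Summit.<Summit>.<Problem>…`: the duplicated component is by design
set_option linter.dupNamespace false

noncomputable section

open scoped Classical
open WeierstrassCurve NumberField IsDedekindDomain Field
open Literature.NumberTheory.EllipticCurves Literature.NumberTheory.GaloisRepresentations

universe u

namespace Summit.BirchSwinnertonDyer.BirchSwinnertonDyer.Theorems.SylvesterTwoCoupledDescentCebotarev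

variable {K : Type u} [Field K] [NumberField K]

/-! ## The pair Čebotarev step at prime level `p = p¹` -/

/-- `exists_kolyvaginPrime_gt_of_galoisElement_pair` (stated in the tree at level `p^M`) at level
`p`, i.e. `M = 1` with `p ^ 1` rewritten to `p` in every binder. [folklore] -/
theorem exists_kolyvaginPrime_gt_of_galoisElement_pair_prime {A B : WeierstrassCurve ℚ}
    (hC : Literature.NumberTheory.Automorphic.chebotarev_artinRep) {NA NB : ℕ} [NeZero NA] [NeZero NB]
    [A.IsElliptic] [B.IsElliptic] (hK : IsImaginaryQuadratic K) {p : ℕ} (hp : p.Prime)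
    {c : K ≃ₐ[ℚ] K} {c₀ : absoluteGaloisGroup ℚ} (hc₀ : IsComplexConjugation (Rat.castHom ℝ) c₀)
    (ht : IsLiftOfAut c (absGaloisTransport (K := ℚ) (L := K) c₀).toRingEquiv)
    (hinv : ∀ x, (absGaloisTransport (K := ℚ) (L := K) c₀).toRingEquiv
      ((absGaloisTransport (K := ℚ) (L := K) c₀).toRingEquiv x) = x)
    {ιA ιB : Type*} [Fintype ιA] [Fintype ιB]
    (csA : ιA → galH1Torsion (A.baseChange K) p) (csB : ιB → galH1Torsion (B.baseChange K) p)
    {ρ : absoluteGaloisGroup K} (hρA : ρ ∈ torsionFixing (A.baseChange K) p)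
    (hρB : ρ ∈ torsionFixing (B.baseChange K) p) (b : ℕ) :
    ∃ ℓ : ℕ, b < ℓ ∧ ℓ.Prime ∧ ¬ ℓ ∣ NA ∧ ¬ ℓ ∣ NB ∧ ¬ ((ℓ : ℤ) ∣ NumberField.discr K) ∧
      ℓ ≠ p ∧ (Ideal.span {(ℓ : 𝓞 K)}).IsPrime ∧
      FrobEqFrobInfty A K p ℓ ∧ FrobEqFrobInfty B K p ℓ ∧
      ∃ m : absoluteGaloisGroup K, m ∈ evalKer (A.baseChange K) p csA ∧
        m ∈ evalKer (B.baseChange K) p csB ∧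
        (∀ x ∈ AddSubgroup.closure (Set.range csA),
          ∀ v : HeightOneSpectrum (𝓞 K), (ℓ : 𝓞 K) ∈ v.asIdeal →
            (x ∈ (A.baseChange K).torsionLocalKer (v.adicCompletion K) p ↔
              h1Eval (A.baseChange K) p x (ht.conjGalCMH (ρ * m) * (ρ * m)) = 0)) ∧
        (∀ y ∈ AddSubgroup.closure (Set.range csB),
          ∀ v : HeightOneSpectrum (𝓞 K), (ℓ : 𝓞 K) ∈ v.asIdeal →
            (y ∈ (B.baseChange K).torsionLocalKer (v.adicCompletion K) p ↔
              h1Eval (B.baseChange K) p y (ht.conjGalCMH (ρ * m) * (ρ * m)) = 0)) := by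
  have key : ∀ {n : ℕ}, p ^ 1 = n →
      ∀ (csA' : ιA → galH1Torsion (A.baseChange K) n)
        (csB' : ιB → galH1Torsion (B.baseChange K) n) {ρ' : absoluteGaloisGroup K},
        ρ' ∈ torsionFixing (A.baseChange K) n → ρ' ∈ torsionFixing (B.baseChange K) n →
      ∃ ℓ : ℕ, b < ℓ ∧ ℓ.Prime ∧ ¬ ℓ ∣ NA ∧ ¬ ℓ ∣ NB ∧ ¬ ((ℓ : ℤ) ∣ NumberField.discr K) ∧
        ℓ ≠ p ∧ (Ideal.span {(ℓ : 𝓞 K)}).IsPrime ∧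
        FrobEqFrobInfty A K n ℓ ∧ FrobEqFrobInfty B K n ℓ ∧
        ∃ m : absoluteGaloisGroup K, m ∈ evalKer (A.baseChange K) n csA' ∧
          m ∈ evalKer (B.baseChange K) n csB' ∧
          (∀ x ∈ AddSubgroup.closure (Set.range csA'),
            ∀ v : HeightOneSpectrum (𝓞 K), (ℓ : 𝓞 K) ∈ v.asIdeal →
              (x ∈ (A.baseChange K).torsionLocalKer (v.adicCompletion K) n ↔
                h1Eval (A.baseChange K) n x (ht.conjGalCMH (ρ' * m) * (ρ' * m)) = 0)) ∧
          (∀ y ∈ AddSubgroup.closure (Set.range csB'),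
            ∀ v : HeightOneSpectrum (𝓞 K), (ℓ : 𝓞 K) ∈ v.asIdeal →
              (y ∈ (B.baseChange K).torsionLocalKer (v.adicCompletion K) n ↔
                h1Eval (B.baseChange K) n y (ht.conjGalCMH (ρ' * m) * (ρ' * m)) = 0)) := by
    intro n hn
    subst hn
    intro csA' csB' ρ' hρA' hρB'
    exact exists_kolyvaginPrime_gt_of_galoisElement_pair hC hK hp (M := 1) hc₀ ht hinv csA' csB'
      hρA' hρB' b
  exact key (pow_one p) csA csB hρA hρB

/-! ## Per-curve bookkeeping: `σ`-fixed families, evaluation on their span, targets -/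

section PerCurve

variable (X : WeierstrassCurve ℚ)

/-- **A `σ`-fixed, `(ℤ/p)[w]`-independent family carrying a class `s` (and a prescribed `σ`-fixed
`x₁ ≠ 0`).** For `K` imaginary quadratic with conjugation `c`, a prime `p ≠ 3`, and an operator
`wH` on `H¹(K, X_K[p])` with `wH² + wH + 1 = 0` and `σ_*(wH x) = wH (wH (σ_* x))`: every class `s`
is `∑ (a_i x_i + b_i wH x_i)` for `σ`-fixed classes `x_i` with no relation
`∑ (a′_i x_i + b′_i wH x_i) = 0` other than `p ∣ a′_i, b′_i`, and a given `σ`-fixed `x₁ ≠ 0` may be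
taken among the `x_i` (memo two §57.4 Step 3: `s = s₀ + ω s₁`, `H = H^σ ⊗ 𝔽₄`; LEMMA D +
`exists_indep_subfamily(_mem)`). [folklore] -/
theorem exists_fixed_family (hK : IsImaginaryQuadratic K) {p : ℕ} (hp : p.Prime) (hp3 : p ≠ 3)
    (c : K ≃ₐ[ℚ] K)
    (wH : galH1Torsion (X.baseChange K) p →+ galH1Torsion (X.baseChange K) p)
    (hwH2 : ∀ x, wH (wH x) + wH x + x = 0)
    (hσw : ∀ x, conjAct X c p (wH x) = wH (wH (conjAct X c p x)))
    (x₁ s : galH1Torsion (X.baseChange K) p) (hx₁ : conjAct X c p x₁ = x₁) :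
    ∃ (r : ℕ) (xs : Fin r → galH1Torsion (X.baseChange K) p) (a b : Fin r → ℤ),
      (∀ i, conjAct X c p (xs i) = xs i) ∧
      (∀ a' b' : Fin r → ℤ, ∑ i, (a' i • xs i + b' i • wH (xs i)) = 0 →
        ∀ i, (p : ℤ) ∣ a' i ∧ (p : ℤ) ∣ b' i) ∧
      s = ∑ i, (a i • xs i + b i • wH (xs i)) ∧
      (x₁ ≠ 0 → ∃ i₀, xs i₀ = x₁) := by
  have hM : ∀ x : galH1Torsion (X.baseChange K) p, (p : ℤ) • x = 0 :=
    zsmul_galH1Torsion_eq_zero _ _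
  have h3 := three_zsmul_bijective_of_prime_torsion hp hp3 hM
  have hσ : ∀ x, conjAct X c p (conjAct X c p x) = x :=
    conjAct_conjAct_of_mul_self X (mul_self_eq_one_of_isImaginaryQuadratic hK c) p
  have hσw' : ∀ x, conjAct X c p (wH x) = -(conjAct X c p x) - wH (conjAct X c p x) := fun x ↦ by
    rw [hσw]
    have h := hwH2 (conjAct X c p x)
    rw [← sub_eq_zero, ← h]
    abel
  obtain ⟨s₀, s₁, hs₀, hs₁, hs⟩ :=
    exists_fixed_add_apply_fixed wH (conjAct X c p) hwH2 hσ hσw' h3 s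
  obtain ⟨u, hu⟩ : ∃ u : Fin 3 → galH1Torsion (X.baseChange K) p, u = ![x₁, s₀, s₁] := ⟨_, rfl⟩
  have hu0 : u 0 = x₁ := by rw [hu]; rfl
  have hu1 : u 1 = s₀ := by rw [hu]; rfl
  have hu2 : u 2 = s₁ := by rw [hu]; rfl
  have hufix : ∀ j, conjAct X c p (u j) = u j := by
    intro j
    subst hu
    fin_cases j
    · simpa using hx₁
    · simpa using hs₀
    · simpa using hs₁
  -- common finish from an independent sub-family of `u` spanning `u`
  have finish : ∀ (r : ℕ) (xs : Fin r → galH1Torsion (X.baseChange K) p),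
      (∀ i, ∃ j, xs i = u j) → (∀ a : Fin r → ℤ, ∑ i, a i • xs i = 0 → ∀ i, (p : ℤ) ∣ a i) →
      (∀ j, ∃ e : Fin r → ℤ, u j = ∑ i, e i • xs i) →
      ∃ a b : Fin r → ℤ, (∀ i, conjAct X c p (xs i) = xs i) ∧
        (∀ a' b' : Fin r → ℤ, ∑ i, (a' i • xs i + b' i • wH (xs i)) = 0 →
          ∀ i, (p : ℤ) ∣ a' i ∧ (p : ℤ) ∣ b' i) ∧
        s = ∑ i, (a i • xs i + b i • wH (xs i)) := by
    intro r xs hmem hind hspan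
    have hfix : ∀ i, conjAct X c p (xs i) = xs i := fun i ↦ by
      obtain ⟨j, hj⟩ := hmem i
      rw [hj, hufix]
    obtain ⟨a, ha⟩ := hspan 1
    obtain ⟨b, hb⟩ := hspan 2
    refine ⟨a, b, hfix, fun a' b' h i ↦
      dvd_and_dvd_of_sum_fixed_eq_zero wH (conjAct X c p) hwH2 hσw' h3 hfix hind a' b' h i, ?_⟩
    rw [hs, ← hu1, ← hu2, ha, hb, map_sum, ← Finset.sum_add_distrib]
    exact Finset.sum_congr rfl fun i _ ↦ by rw [map_zsmul]
  by_cases hx0 : x₁ = 0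
  · obtain ⟨r, xs, hmem, hind, hspan⟩ := exists_indep_subfamily hp hM u
    obtain ⟨a, b, h1, h2, h3'⟩ := finish r xs hmem hind hspan
    exact ⟨r, xs, a, b, h1, h2, h3', fun h ↦ absurd hx0 h⟩
  · obtain ⟨r, xs, ⟨i₀, hi₀⟩, hmem, hind, hspan⟩ :=
      exists_indep_subfamily_mem hp hM u 0 (by rw [hu0]; exact hx0)
    obtain ⟨a, b, h1, h2, h3'⟩ := finish r xs hmem hind hspan
    exact ⟨r, xs, a, b, h1, h2, h3', fun _ ↦ ⟨i₀, hi₀.trans hu0⟩⟩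

/-- **A class of the span lies in the subgroup generated by the `x_i` and the `wH x_i`** (the
family fed to the Čebotarev step). [folklore] -/
theorem sum_mem_closure_range {p : ℕ}
    (wH : galH1Torsion (X.baseChange K) p →+ galH1Torsion (X.baseChange K) p)
    {r : ℕ} (xs : Fin r → galH1Torsion (X.baseChange K) p) (a b : Fin r → ℤ) :
    (∑ i, (a i • xs i + b i • wH (xs i))) ∈
      AddSubgroup.closure (Set.range (Sum.elim xs (wH ∘ xs))) := by
  refine sum_mem fun i _ ↦ add_mem ?_ ?_
  · have h : xs i ∈ AddSubgroup.closure (Set.range (Sum.elim xs (wH ∘ xs))) :=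
      AddSubgroup.subset_closure ⟨Sum.inl i, rfl⟩
    exact zsmul_mem h _
  · have h : wH (xs i) ∈ AddSubgroup.closure (Set.range (Sum.elim xs (wH ∘ xs))) :=
      AddSubgroup.subset_closure ⟨Sum.inr i, rfl⟩
    exact zsmul_mem h _

/-- **Evaluation of `F = (τ⁻¹(ρm)τ)(ρm)` on a class of the span** (the `(1+τ)`-bookkeeping of
`h1Eval_conj_mul_eq_of_h1Eval_eq`, summed): for `σ`-fixed `x_i`, `ρ ∈ Γ_{K(X[p])}` with
`[x_i, ρ] = v_i` and `m` killing all `[x_i, ·]`, `[wH x_i, ·]`,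
`[∑ (a_i x_i + b_i wH x_i), F] = ∑ (a_i (τv_i + v_i) + b_i w (τv_i + v_i))`.
[cite: McCallumLMS1991, Prop. 3.1 (proof)] -/
theorem h1Eval_sum_conj_mul_eq {c : K ≃ₐ[ℚ] K} {τ : AlgebraicClosure K ≃+* AlgebraicClosure K}
    (ht : IsLiftOfAut c τ) (hinv : ∀ x, τ (τ x) = x) {p : ℕ}
    (w : geomTorsion (X.baseChange K) p →+ geomTorsion (X.baseChange K) p)
    (hw3 : ∀ P, w (w (w P)) = P)
    (wH : galH1Torsion (X.baseChange K) p →+ galH1Torsion (X.baseChange K) p)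
    (hwH : ∀ x, ∀ ρ ∈ torsionFixing (X.baseChange K) p,
      h1Eval (X.baseChange K) p (wH x) ρ = w (h1Eval (X.baseChange K) p x ρ))
    (hσw : ∀ x, conjAct X c p (wH x) = wH (wH (conjAct X c p x)))
    (hτw : ∀ P, ht.torsionMap X p (w P) = w (w (ht.torsionMap X p P)))
    {r : ℕ} {xs : Fin r → galH1Torsion (X.baseChange K) p}
    (hxs : ∀ i, conjAct X c p (xs i) = xs i) {ρ : absoluteGaloisGroup K}
    (hρ : ρ ∈ torsionFixing (X.baseChange K) p) (v : Fin r → geomTorsion (X.baseChange K) p)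
    (hρv : ∀ i, h1Eval (X.baseChange K) p (xs i) ρ = v i) {m : absoluteGaloisGroup K}
    (hm : m ∈ evalKer (X.baseChange K) p (Sum.elim xs (wH ∘ xs))) (a b : Fin r → ℤ) :
    h1Eval (X.baseChange K) p (∑ i, (a i • xs i + b i • wH (xs i)))
        (ht.conjGalCMH (ρ * m) * (ρ * m)) =
      ∑ i, (a i • (ht.torsionMap X p (v i) + v i) + b i • w (ht.torsionMap X p (v i) + v i)) := by
  have hm' : m ∈ evalKer (X.baseChange K) p xs := ⟨hm.1, fun i ↦ hm.2 (Sum.inl i)⟩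
  have hρm : ρ * m ∈ torsionFixing (X.baseChange K) p := mul_mem hρ hm.1
  have hF : ht.conjGalCMH (ρ * m) * (ρ * m) ∈ torsionFixing (X.baseChange K) p :=
    mul_mem (ht.conjGalCMH_mem_torsionFixing X hinv _ hρm) hρm
  have hb := fun i ↦
    h1Eval_conj_mul_eq_of_h1Eval_eq X ht hinv w hw3 wH hwH hσw hτw hxs hρ v hρv hm' i
  exact h1Eval_sum_eq_sum X w wH (fun i ↦ ht.torsionMap X p (v i) + v i) hF
    (fun i ↦ (hb i).1) (fun i ↦ (hb i).2) a b

/-- **Indicator targets**: with `v = e′` at `i₀` and `0` elsewhere, the evaluation sum collapses to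
`a_{i₀} e₀ + b_{i₀} w e₀`, `e₀ = τe′ + e′`. [folklore] -/
theorem sum_indicator_eq {c : K ≃ₐ[ℚ] K} {τ : AlgebraicClosure K ≃+* AlgebraicClosure K}
    (ht : IsLiftOfAut c τ) {p : ℕ}
    (w : geomTorsion (X.baseChange K) p →+ geomTorsion (X.baseChange K) p)
    {r : ℕ} (a b : Fin r → ℤ) (i₀ : Fin r) (e' : geomTorsion (X.baseChange K) p) :
    (∑ i, (a i • (ht.torsionMap X p (if i = i₀ then e' else 0) + (if i = i₀ then e' else 0)) +
        b i • w (ht.torsionMap X p (if i = i₀ then e' else 0) + (if i = i₀ then e' else 0)))) =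
      a i₀ • (ht.torsionMap X p e' + e') + b i₀ • w (ht.torsionMap X p e' + e') := by
  rw [Finset.sum_eq_single i₀]
  · simp
  · intro i _ hi
    simp [hi]
  · intro h
    exact absurd (Finset.mem_univ i₀) h

/-- **Choice of targets making a non-zero class visible**: if `s = ∑ (a_i x_i + b_i wH x_i) ≠ 0`
and `(e₀, w e₀)` is `p`-independent (`e₀ = τe′ + e′`), some indicator target `v` has
`∑ (a_i (τv_i + v_i) + b_i w(τv_i + v_i)) ≠ 0`. [folklore] -/
theorem exists_target_of_ne_zero {c : K ≃ₐ[ℚ] K} {τ : AlgebraicClosure K ≃+* AlgebraicClosure K}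
    (ht : IsLiftOfAut c τ) {p : ℕ}
    (w : geomTorsion (X.baseChange K) p →+ geomTorsion (X.baseChange K) p)
    (wH : galH1Torsion (X.baseChange K) p →+ galH1Torsion (X.baseChange K) p)
    (e' : geomTorsion (X.baseChange K) p)
    (hind : ∀ a b : ℤ, a • (ht.torsionMap X p e' + e') + b • w (ht.torsionMap X p e' + e') = 0 →
      (p : ℤ) ∣ a ∧ (p : ℤ) ∣ b)
    {r : ℕ} (xs : Fin r → galH1Torsion (X.baseChange K) p) (a b : Fin r → ℤ) {s}
    (hs : s = ∑ i, (a i • xs i + b i • wH (xs i))) :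
    ∃ v : Fin r → geomTorsion (X.baseChange K) p, s ≠ 0 →
      (∑ i, (a i • (ht.torsionMap X p (v i) + v i) + b i • w (ht.torsionMap X p (v i) + v i))) ≠ 0 := by
  by_cases hs0 : s = 0
  · exact ⟨fun _ ↦ 0, fun h ↦ absurd hs0 h⟩
  · have hM : ∀ x : galH1Torsion (X.baseChange K) p, (p : ℤ) • x = 0 :=
      zsmul_galH1Torsion_eq_zero _ _
    obtain ⟨i₀, hi₀⟩ := exists_not_dvd_of_sum_ne_zero wH hM xs a b (hs ▸ hs0)
    exact ⟨fun i ↦ if i = i₀ then e' else 0, fun _ h ↦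
      hi₀ (hind _ _ ((sum_indicator_eq X ht w a b i₀ e').symm.trans h))⟩

end PerCurve

/-! ## (hL3a) and (hL3b) -/

section Main

variable {A B : WeierstrassCurve ℚ} [A.IsElliptic] [B.IsElliptic]

/-- **Leaf (L3), clause (a)** — the `ceb_ne` / `hL3a` hypothesis of
`SylvesterTwoCoupledDescent.selmerGroup_eq_bot_and_le_closure_of_coupledLeaves`, PROVED from the
displayed module-theoretic data: for any classes `s ∈ H¹(K, A_K[p])`, `t ∈ H¹(K, B_K[p])` there are
infinitely many primes `ℓ` — Kolyvagin primes: `ℓ ∤ N_A N_B d_K`, `ℓ ≠ p`, `(ℓ)` prime in `𝓞 K`,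
`Frob(ℓ) = Frob(∞)` on `K(A_p)` and `K(B_p)` — such that at the place `λ ∋ ℓ`, `s_λ ≠ 0` if `s ≠ 0`
and `t_λ ≠ 0` if `t ≠ 0`. Proof: write `s`, `t` on `σ`-fixed independent families
(`exists_fixed_family`), choose indicator targets (`exists_target_of_ne_zero`), realize them by ONE
`ρ ∈ Γ_{K(A[p])} ∩ Γ_{K(B[p])}` (`exists_h1Eval_eq_pair_of_comm`), and apply the pair Čebotarev step
(`exists_kolyvaginPrime_gt_of_galoisElement_pair`, with `Automorphic.chebotarev_artinRep_holds`):
McCallum's criterion `x_λ = 0 ⟺ [x, (ρm)^τ(ρm)] = 0` and the bookkeeping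
`[s, (ρm)^τ(ρm)] = a_{i₀} e₀ + b_{i₀} w e₀ ≠ 0`. Memo two §57.4 Steps 2–5, 7.
[cite: McCallumLMS1991, §3 Cor. 3.2 (proof)] -/
theorem infinite_kolyvaginPrimes_ne {NA NB : ℕ} [NeZero NA] [NeZero NB]
    (hK : IsImaginaryQuadratic K) {p : ℕ} (hp : p.Prime) (hp3 : p ≠ 3)
    {c : K ≃ₐ[ℚ] K} {c₀ : absoluteGaloisGroup ℚ} (hc₀ : IsComplexConjugation (Rat.castHom ℝ) c₀)
    (ht : IsLiftOfAut c (absGaloisTransport (K := ℚ) (L := K) c₀).toRingEquiv)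
    -- data for `A`
    (hSA : ∀ H : AddSubgroup (geomTorsion (A.baseChange K) p),
      (∀ g : absoluteGaloisGroup K, ∀ t ∈ H, g • t ∈ H) → H = ⊥ ∨ H = ⊤)
    (wA : geomTorsion (A.baseChange K) p →+ geomTorsion (A.baseChange K) p)
    (hw3A : ∀ P, wA (wA (wA P)) = P)
    (hCA : ∀ f : geomTorsion (A.baseChange K) p →+ geomTorsion (A.baseChange K) p,
      (∀ (g : absoluteGaloisGroup K) (t : geomTorsion (A.baseChange K) p), f (g • t) = g • f t) →
        ∃ a b : ℤ, ∀ t, f t = a • t + b • wA t)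
    (hcommA : ∀ (g h : absoluteGaloisGroup K) (P : geomTorsion (A.baseChange K) p),
      g • h • P = h • g • P)
    {zA₀ : absoluteGaloisGroup K}
    (ιA : geomTorsion (A.baseChange K) p →+ geomTorsion (A.baseChange K) p)
    (hιA : ∀ P, ιA (zA₀ • P - P) = P)
    (hιAg : ∀ (g : absoluteGaloisGroup K) (P : geomTorsion (A.baseChange K) p),
      ιA (g • P) = g • ιA P)
    (wHA : galH1Torsion (A.baseChange K) p →+ galH1Torsion (A.baseChange K) p)
    (hwH2A : ∀ x, wHA (wHA x) + wHA x + x = 0)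
    (hwHA : ∀ x, ∀ ρ ∈ torsionFixing (A.baseChange K) p,
      h1Eval (A.baseChange K) p (wHA x) ρ = wA (h1Eval (A.baseChange K) p x ρ))
    (hσwA : ∀ x, conjAct A c p (wHA x) = wHA (wHA (conjAct A c p x)))
    (hτwA : ∀ P, ht.torsionMap A p (wA P) = wA (wA (ht.torsionMap A p P)))
    {eA : ℕ} (hpowA : ∀ ρ : absoluteGaloisGroup K, ρ ^ eA ∈ torsionFixing (B.baseChange K) p)
    (heA : ∀ P : geomTorsion (A.baseChange K) p, eA • P = P)
    {zA : absoluteGaloisGroup K} (hzA : zA ∈ torsionFixing (B.baseChange K) p)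
    (hzAsurj : ∀ Q : geomTorsion (A.baseChange K) p,
      ∃ P : geomTorsion (A.baseChange K) p, zA • P - P = Q)
    (eA' : geomTorsion (A.baseChange K) p)
    (hindEA : ∀ a b : ℤ,
      a • (ht.torsionMap A p eA' + eA') + b • wA (ht.torsionMap A p eA' + eA') = 0 →
        (p : ℤ) ∣ a ∧ (p : ℤ) ∣ b)
    -- data for `B`
    (hSB : ∀ H : AddSubgroup (geomTorsion (B.baseChange K) p),
      (∀ g : absoluteGaloisGroup K, ∀ t ∈ H, g • t ∈ H) → H = ⊥ ∨ H = ⊤)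
    (wB : geomTorsion (B.baseChange K) p →+ geomTorsion (B.baseChange K) p)
    (hw3B : ∀ P, wB (wB (wB P)) = P)
    (hCB : ∀ f : geomTorsion (B.baseChange K) p →+ geomTorsion (B.baseChange K) p,
      (∀ (g : absoluteGaloisGroup K) (t : geomTorsion (B.baseChange K) p), f (g • t) = g • f t) →
        ∃ a b : ℤ, ∀ t, f t = a • t + b • wB t)
    (hcommB : ∀ (g h : absoluteGaloisGroup K) (P : geomTorsion (B.baseChange K) p),
      g • h • P = h • g • P)
    {zB₀ : absoluteGaloisGroup K}
    (ιB : geomTorsion (B.baseChange K) p →+ geomTorsion (B.baseChange K) p)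
    (hιB : ∀ P, ιB (zB₀ • P - P) = P)
    (hιBg : ∀ (g : absoluteGaloisGroup K) (P : geomTorsion (B.baseChange K) p),
      ιB (g • P) = g • ιB P)
    (wHB : galH1Torsion (B.baseChange K) p →+ galH1Torsion (B.baseChange K) p)
    (hwH2B : ∀ x, wHB (wHB x) + wHB x + x = 0)
    (hwHB : ∀ x, ∀ ρ ∈ torsionFixing (B.baseChange K) p,
      h1Eval (B.baseChange K) p (wHB x) ρ = wB (h1Eval (B.baseChange K) p x ρ))
    (hσwB : ∀ x, conjAct B c p (wHB x) = wHB (wHB (conjAct B c p x)))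
    (hτwB : ∀ P, ht.torsionMap B p (wB P) = wB (wB (ht.torsionMap B p P)))
    {eB : ℕ} (hpowB : ∀ ρ : absoluteGaloisGroup K, ρ ^ eB ∈ torsionFixing (A.baseChange K) p)
    (heB : ∀ P : geomTorsion (B.baseChange K) p, eB • P = P)
    {zB : absoluteGaloisGroup K} (hzB : zB ∈ torsionFixing (A.baseChange K) p)
    (hzBsurj : ∀ Q : geomTorsion (B.baseChange K) p,
      ∃ P : geomTorsion (B.baseChange K) p, zB • P - P = Q)
    (eB' : geomTorsion (B.baseChange K) p)
    (hindEB : ∀ a b : ℤ,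
      a • (ht.torsionMap B p eB' + eB') + b • wB (ht.torsionMap B p eB' + eB') = 0 →
        (p : ℤ) ∣ a ∧ (p : ℤ) ∣ b)
    (s : galH1Torsion (A.baseChange K) p) (t : galH1Torsion (B.baseChange K) p) :
    Set.Infinite {ℓ : ℕ | (ℓ.Prime ∧ ¬ ℓ ∣ NA ∧ ¬ ℓ ∣ NB ∧ ¬ ((ℓ : ℤ) ∣ NumberField.discr K) ∧
        ℓ ≠ p ∧ (Ideal.span {(ℓ : 𝓞 K)}).IsPrime ∧
        FrobEqFrobInfty A K p ℓ ∧ FrobEqFrobInfty B K p ℓ) ∧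
      ∀ v : HeightOneSpectrum (𝓞 K), (ℓ : 𝓞 K) ∈ v.asIdeal →
        (s ≠ 0 → s ∉ (A.baseChange K).torsionLocalKer (v.adicCompletion K) p) ∧
        (t ≠ 0 → t ∉ (B.baseChange K).torsionLocalKer (v.adicCompletion K) p)} := by
  have hinv : ∀ x, (absGaloisTransport (K := ℚ) (L := K) c₀).toRingEquiv
      ((absGaloisTransport (K := ℚ) (L := K) c₀).toRingEquiv x) = x := fun x ↦
    RatClosure.absGaloisTransport_absGaloisTransport_of_sq_eq_one hc₀.sq_eq_one x
  refine Set.infinite_of_forall_exists_gt fun b ↦ ?_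
  -- `σ`-fixed families carrying `s` and `t`
  obtain ⟨r, xs, aS, bS, hxs, hindA, hs, -⟩ :=
    exists_fixed_family A hK hp hp3 c wHA hwH2A hσwA 0 s (map_zero _)
  obtain ⟨r', ys, aT, bT, hys, hindB, hts, -⟩ :=
    exists_fixed_family B hK hp hp3 c wHB hwH2B hσwB 0 t (map_zero _)
  -- targets
  obtain ⟨vA, hvA⟩ := exists_target_of_ne_zero A ht wA wHA eA' hindEA xs aS bS hs
  obtain ⟨vB, hvB⟩ := exists_target_of_ne_zero B ht wB wHB eB' hindEB ys aT bT hts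
  -- the joint Galois element
  obtain ⟨ρ, hρ, hρA, hρB⟩ := exists_h1Eval_eq_pair_of_comm (A.baseChange K) (B.baseChange K) hp
    hSA wA hCA hcommA ιA hιA hιAg wHA hwHA hpowA heA hzA hzAsurj
    hSB wB hCB hcommB ιB hιB hιBg wHB hwHB hpowB heB hzB hzBsurj xs hindA ys hindB vA vB
  have hρTA : ρ ∈ torsionFixing (A.baseChange K) p := (Subgroup.mem_inf.mp hρ).1
  have hρTB : ρ ∈ torsionFixing (B.baseChange K) p := (Subgroup.mem_inf.mp hρ).2
  -- the Kolyvagin prime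
  obtain ⟨ℓ, hbℓ, hℓ, hℓNA, hℓNB, hℓD, hℓp, hprime, hfrobA, hfrobB, m, hmA, hmB, hlocA, hlocB⟩ :=
    exists_kolyvaginPrime_gt_of_galoisElement_pair_prime (NA := NA) (NB := NB)
      (Literature.NumberTheory.Automorphic.chebotarev_artinRep_holds) hK hp hc₀ ht hinv
      (Sum.elim xs (wHA ∘ xs)) (Sum.elim ys (wHB ∘ ys)) hρTA hρTB b
  refine ⟨ℓ, ⟨⟨hℓ, hℓNA, hℓNB, hℓD, hℓp, hprime, hfrobA, hfrobB⟩, fun v hv ↦ ⟨?_, ?_⟩⟩, hbℓ⟩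
  · intro hs0 hmem
    apply hvA hs0
    rw [← h1Eval_sum_conj_mul_eq A ht hinv wA hw3A wHA hwHA hσwA hτwA hxs hρTA vA hρA hmA aS bS,
      ← hs]
    exact (hlocA s (hs ▸ sum_mem_closure_range A wHA xs aS bS) v hv).mp hmem
  · intro ht0 hmem
    apply hvB ht0
    rw [← h1Eval_sum_conj_mul_eq B ht hinv wB hw3B wHB hwHB hσwB hτwB hys hρTB vB hρB hmB aT bT,
      ← hts]
    exact (hlocB t (hts ▸ sum_mem_closure_range B wHB ys aT bT) v hv).mp hmem

end Main

end Summit.BirchSwinnertonDyer.BirchSwinnertonDyer.Theorems.SylvesterTwoCoupledDescentCebotarev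

end
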